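import Literature.IUT.LogThetaLattice.TensorPacketsAtInclusion
import HarnessLib

/-!
# [IUTchIII] Proposition 3.2 (i)/(ii): naturality of `log(^{A,α}𝒟^⊢_v) ⊆ log(^A𝒟^⊢_{v_ℚ})` under the compatibility isomorphisms

S. Mochizuki, *Inter-universal Teichmüller theory III*, kurims manuscript (May 2020), §3, Proposition
3.2 "(Local Mono-analytic Tensor Packets)", p. 98 (PRIMS **57** (2021), offset ≈ +420), node
**IUTchIII:Prop3.2(i)** with (ii) and the preamble "`log(^{A,α}𝒟^⊢_v) ⊆ log(^A𝒟^⊢_{v_ℚ})`", and Prop. 3.1 (ii)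
p. 93 (holomorphic packets). PROOF-ONLY companion (no definitions) of `TensorPacketsAtInclusion.lean`
(abc-iut-w5-d003, p412954, DEFINITION FROZEN 28df536e152bec9c — hence a separate file rather than an
append) over `TensorPackets.lean` / `TensorPacketsProofs.lean` (abc-iut-L6-t4 / -t5).

PRINT (p. 98, (i)): the poly-isomorphisms `log(†𝒟^⊢_v) ⥲ log(†𝓕^{⊢×μ}_v) ⥲ log(†𝓕_v)` of Prop. 1.2 (vi),
(vii) "induce NATURAL poly-isomorphisms of ind-topological modules `log(^α𝒟^⊢_{v_ℚ}) ⥲ … ⥲ log(^α𝓕_{v_ℚ})`;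
`log(^A𝒟^⊢_{v_ℚ}) ⥲ … ⥲ log(^A𝓕_{v_ℚ})`; `log(^{A,α}𝒟^⊢_v) ⥲ … ⥲ log(^{A,α}𝓕_v)`".  The typed members of these
poly-isomorphisms are `MPacketN.compat e` and `MPacketAt.compat e α v` (`TensorPackets.lean`), induced by ONE
family `e` of component isomorphisms.  WHAT THIS FILE PROVES: they COMMUTE with the inclusions of the
`(A,α)`-packets into the `n`-packets (`MPacketAt.compat_incl`) — the naturality square implicit in
"natural" + "`⊆`" — where the SAME `MPacketAt.incl` serves the holomorphic side because
`MPacketAt 𝕜 (fun α v => L α v) α v = PacketAt 𝕜 L α v` and `MPacketN 𝕜 (fun α v => L α v) = PacketN 𝕜 L`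
definitionally (`PacketAt.incl_injective`: the printed "`log(^{A,α}𝓕_v)` … direct summand of … `log(^A𝓕_{v_ℚ})`"
of Prop. 3.1 (ii) at the module level); and the nonarchimedean trace identity of p412954 in IMAGE form,
`incl(𝓘(^{A,α}𝒟^⊢_v)) = 𝓘(^A𝒟^⊢_{v_ℚ}) ∩ log(^{A,α}𝒟^⊢_v)` (`map_incl_shellPacketAt_eq`; first written as an
audit probe by abc-iut-w5-d181).  Record-only typing under the claim key `Mochizuki2012` (D-0012,
disputed); the content is undisputed multilinear algebra; nothing here takes a side on [IUTchIII]
Cor. 3.12; typed ≠ discharged.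
-/

noncomputable section

namespace Literature.IUT.LogThetaLattice

open scoped TensorProduct
open PiTensorProduct Function

universe u v v' w

section Naturality

variable (𝕜 : Type u) [Field 𝕜]
variable {A : Type v} [DecidableEq A]
variable {Vfib : Type v'} [DecidableEq Vfib]
variable (D : A → Vfib → Type w) [∀ α v, AddCommGroup (D α v)] [∀ α v, Module 𝕜 (D α v)]
variable {L : A → Vfib → Type w} [∀ α v, CommRing (L α v)] [∀ α v, Algebra 𝕜 (L α v)]

variable {D} in
omit [DecidableEq Vfib] [∀ α v, Module 𝕜 (D α v)] in
/-- Reassembling commutes with componentwise maps: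
`(f_{γ,w} (insertAt α m y)_{γ,w})_{γ,w} = insertAt α (f_{α,·} m) (f_{β,·} y_β)_β`. [claim: Mochizuki2012, status: disputed] -/
theorem MPacket1.map_insertAt {D' : A → Vfib → Type w} [∀ α v, AddCommGroup (D' α v)] (α : A)
    (f : ∀ (γ : A) (w : Vfib), D γ w → D' γ w) (m : MPacket1 D α)
    (y : ∀ β : {β : A // β ≠ α}, MPacket1 D β.1) :
    (fun γ w => f γ w (MPacket1.insertAt α m y γ w)) =
      MPacket1.insertAt α (fun w => f α w (m w)) (fun β w => f β.1 w (y β w)) := by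
  funext γ w
  by_cases h : γ ≠ α
  · rw [MPacket1.insertAt_of_ne α m y h, MPacket1.insertAt_of_ne α _ _ h]
  · obtain rfl : γ = α := not_not.mp h
    rw [MPacket1.insertAt_self, MPacket1.insertAt_self]

omit [DecidableEq A] in
/-- A componentwise linear isomorphism `log(^α𝒟^⊢_w) ≅ log(^α𝓕_w)` (a member of the poly-isomorphism of
Prop. 1.2 (vi), (vii)) maps the vector of `⊕_w log(^α𝒟^⊢_w)` supported at `w = v` with value `x` to the vector
supported at `v` with value `e_v x`. [claim: Mochizuki2012, status: disputed] -/
theorem MPacket1.compat_single (α : A) (e : ∀ w : Vfib, D α w ≃ₗ[𝕜] L α w) (v : Vfib) (x : D α v) :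
    (fun w => e w (Pi.single v x w)) = Pi.single v (e v x) := by
  funext w
  by_cases hw : w = v
  · subst hw; rw [Pi.single_eq_same, Pi.single_eq_same]
  · rw [Pi.single_eq_of_ne hw, Pi.single_eq_of_ne hw, map_zero]

/-- **IUTchIII:Prop3.2(i) — naturality of the compatibility isomorphisms with respect to
`log(^{A,α}(−)_v) ⊆ log(^A(−)_{v_ℚ})`** (p. 98, "induce NATURAL poly-isomorphisms …
`log(^A𝒟^⊢_{v_ℚ}) ⥲ log(^A𝓕_{v_ℚ})`; `log(^{A,α}𝒟^⊢_v) ⥲ log(^{A,α}𝓕_v)`"): for one family `e` of component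
isomorphisms, the induced `n`-packet isomorphism (`MPacketN.compat e`) and `(A,α)`-packet isomorphism
(`MPacketAt.compat e α v`) form a commutative square with the two inclusions `incl`:
`compat_N ∘ incl = incl ∘ compat_{A,α}`. Proof on generators `x ⊗ (⊗_β y_β)` (both paths give
`⊗_γ (insertAt α (0,…,e_v x,…,0) (e y_β)_β)_γ`, by `map_insertAt` and `compat_single`), extended by
(multi)linearity. [claim: Mochizuki2012, status: disputed] -/
theorem MPacketAt.compat_incl (e : ∀ α v, D α v ≃ₗ[𝕜] L α v) (α : A) (v : Vfib) (t : MPacketAt 𝕜 D α v) :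
    MPacketN.compat e (MPacketAt.incl 𝕜 D α v t) =
      MPacketAt.incl 𝕜 (fun α v => L α v) α v (MPacketAt.compat e α v t) := by
  induction t using TensorProduct.induction_on with
  | zero => simp only [map_zero]
  | add a b ha hb => rw [map_add, map_add, map_add, map_add, ha, hb]
  | tmul x w =>
    induction w using PiTensorProduct.induction_on with
    | smul_tprod r y =>
      have key : (fun γ w => e γ w (MPacket1.insertAt α (Pi.single v x) y γ w)) =
          MPacket1.insertAt α (Pi.single v (e α v x)) (fun β w => e β.1 w (y β w)) := by
        rw [← MPacket1.compat_single 𝕜 D α (e α) v x]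
        exact MPacket1.map_insertAt α (fun γ w => e γ w) (Pi.single v x) y
      rw [TensorProduct.tmul_smul, map_smul, map_smul, map_smul, map_smul, MPacketAt.incl_tmul_tprod,
        MPacketN.compat_tprod, MPacketAt.compat_tmul, MPacketAt.incl_tmul_tprod, key]
    | add a b ha hb => rw [TensorProduct.tmul_add, map_add, map_add, map_add, map_add, ha, hb]

/-- The square as an identity of linear maps: `compat_N ∘ₗ incl = incl ∘ₗ compat_{A,α}`.
[claim: Mochizuki2012, status: disputed] -/
theorem MPacketAt.compat_comp_incl (e : ∀ α v, D α v ≃ₗ[𝕜] L α v) (α : A) (v : Vfib) :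
    (MPacketN.compat e).toLinearMap ∘ₗ MPacketAt.incl 𝕜 D α v =
      MPacketAt.incl 𝕜 (fun α v => L α v) α v ∘ₗ (MPacketAt.compat e α v).toLinearMap := by
  exact LinearMap.ext fun t => MPacketAt.compat_incl 𝕜 D e α v t

/-- **[IUTchIII] Prop. 3.1 (ii), p. 93, at the module level**: the holomorphic packets are served by the
SAME inclusion — the `(A,α)`-packet `log(^{A,α}𝓕_v)` (`PacketAt`) and the `n`-packet `log(^A𝓕_{v_ℚ})`
(`PacketN`) ARE the mono-analytic packets of the underlying modules (definitionally), so
`MPacketAt.incl 𝕜 (fun α v => L α v) α v : PacketAt 𝕜 L α v →ₗ PacketN 𝕜 L` is the (injective) printed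
"`log(^{A,α}𝓕_v) ⊆ log(^A𝓕_{v_ℚ})`" (multiplicative but not unital; the ring-theoretic "direct summand"
reading is `Prop31ii_directSummand'`, PROVED in `TensorPacketsProofs.lean`). [claim: Mochizuki2012, status: disputed] -/
theorem PacketAt.incl_injective (α : A) (v : Vfib) :
    Function.Injective
      (MPacketAt.incl 𝕜 (fun α v => L α v) α v : PacketAt 𝕜 L α v →ₗ[𝕜] PacketN 𝕜 L) :=
  MPacketAt.incl_injective 𝕜 (fun α v => L α v) α v

/-- The holomorphic compatibility isomorphism followed by the holomorphic inclusion is injective on the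
mono-analytic `(A,α)`-packet (equivalently, by `compat_incl`, `incl` followed by `compat_N`).
[claim: Mochizuki2012, status: disputed] -/
theorem MPacketAt.compat_incl_injective (e : ∀ α v, D α v ≃ₗ[𝕜] L α v) (α : A) (v : Vfib) :
    Function.Injective fun t : MPacketAt 𝕜 D α v =>
      MPacketAt.incl 𝕜 (fun α v => L α v) α v (MPacketAt.compat e α v t) :=
  (PacketAt.incl_injective 𝕜 (L := L) α v).comp (MPacketAt.compat e α v).injective

/-! ### The nonarchimedean trace identity in image form -/

/-- **IUTchIII:Prop3.2(ii)**, nonarchimedean `v_ℚ` (p. 98), image form of the trace identity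
`comap_incl_shellPacketN` of p412954: `incl(𝓘(^{A,α}𝒟^⊢_v)) = 𝓘(^A𝒟^⊢_{v_ℚ}) ∩ log(^{A,α}𝒟^⊢_v)` as additive
subgroups of `log(^A𝒟^⊢_{v_ℚ})` (first recorded as an RQ7 kernel probe by abc-iut-w5-d181).
[claim: Mochizuki2012, status: disputed] -/
theorem MPacketAt.map_incl_shellPacketAt_eq (I : ∀ α v, AddSubgroup (D α v)) (α : A) (v : Vfib) :
    (shellPacketAt 𝕜 D I α v).map (MPacketAt.incl 𝕜 D α v).toAddMonoidHom =
      shellPacketN 𝕜 D I ⊓ (LinearMap.range (MPacketAt.incl 𝕜 D α v)).toAddSubgroup := by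
  refine le_antisymm (le_inf (MPacketAt.map_incl_shellPacketAt_le 𝕜 D I α v) ?_) ?_
  · rintro _ ⟨t, -, rfl⟩
    exact ⟨t, rfl⟩
  · rintro s ⟨hs, ⟨t, rfl⟩⟩
    exact ⟨t, (MPacketAt.incl_mem_shellPacketN_iff 𝕜 D I α v t).mp hs, rfl⟩

end Naturality

end Literature.IUT.LogThetaLattice

end
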